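import Mathlib

/-!
# Level-1 pointwise bounds: absorption toolkit and scale facts (group U, preliminaries)

Helper file for the line `log-lipschitz-budget` of the crux
`ImplosionDichotomy.PolynomialCompression` (stub `stub_logBudgetShadowing`, blueprint §4, level 1),
serving the group-U pointwise bound `level1_groupU_pointwise_bound` (next file).  It contains the
elementary real-number toolkit used to absorb the terms of the level-1 energy identity:
products of energy-controlled amplitudes (`prod_le`), top × top cross terms (`top_le`), forcings
against `√e₁` (`forcing_le`), weighted level-0 amplitudes (`amp_le`), the `3 × 3` summation
(`sum9`); the comparison of the energy weights `A = θ(ζ0+ζ1)/ρ`, `B = 3ρ/(2θ)`, `ρ` with the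
reference scales (`level1_groupU_weights_dominate`, registered helper); and the bookkeeping of the
envelope `V = (1 + c₁ + c₁⁻¹)³ (1 + K + K⁻¹)` (`env_facts`, `env_final`).  (The product bound
`|p q| ≤ P Q` is `Literature.Analysis.FluidPDE.CompressibleEuler.abs_mul_le_of_le`, imported by the
next file.)  Pure real-number inequalities; Mathlib only.
-/

namespace Summit.AtomisticToContinuum.HydrodynamicLimit.Theorems

namespace Level1U

/-! ### Elementary absorption lemmas -/

/-- `|p| ≤ p` for `p ≥ 0` (feeds numerals and nonnegative atoms to product bounds). [folklore] -/
theorem an {p : ℝ} (hp : 0 ≤ p) : |p| ≤ p := (abs_of_nonneg hp).le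

/-- `|p + q + r + u + v| ≤ |p| + |q| + |r| + |u| + |v|`. [folklore] -/
theorem abs_add_five (p q r u v : ℝ) :
    |p + q + r + u + v| ≤ |p| + |q| + |r| + |u| + |v| := by
  have h1 := abs_add_three (p + q + r) u v
  have h2 := abs_add_three p q r
  linarith

/-- Product of two energy-controlled amplitudes: if `P x² ≤ 2E`, `Q y² ≤ 2E` and the weight
product dominates `1/κ²`, then `|x| |y| ≤ 2 κ E`. [folklore] -/
theorem prod_le {P Q E κ x y : ℝ} (hQ : 0 ≤ Q) (hκ : 0 ≤ κ) (hE : 0 ≤ E)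
    (hx : P * x ^ 2 ≤ 2 * E) (hy : Q * y ^ 2 ≤ 2 * E) (h1 : 1 ≤ κ ^ 2 * (P * Q)) :
    |x| * |y| ≤ 2 * κ * E := by
  have h : (|x| * |y|) ^ 2 ≤ (2 * κ * E) ^ 2 :=
    calc (|x| * |y|) ^ 2 = 1 * (x ^ 2 * y ^ 2) := by rw [mul_pow, sq_abs, sq_abs, one_mul]
      _ ≤ κ ^ 2 * (P * Q) * (x ^ 2 * y ^ 2) := mul_le_mul_of_nonneg_right h1 (by positivity)
      _ = κ ^ 2 * ((P * x ^ 2) * (Q * y ^ 2)) := by ring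
      _ ≤ κ ^ 2 * ((2 * E) * (2 * E)) := by gcongr
      _ = (2 * κ * E) ^ 2 := by ring
  exact (le_abs_self _).trans (abs_le_of_sq_le_sq h (by positivity))

/-- A top-order cross term `c x y` is at most `M R` when `|c| ≤ M`, `|x| |y| ≤ R`. [folklore] -/
theorem top_le {c x y M R : ℝ} (hc : |c| ≤ M) (hxy : |x| * |y| ≤ R) :
    c * x * y ≤ M * R :=
  calc c * x * y ≤ |c * x * y| := le_abs_self _
    _ = |c| * (|x| * |y|) := by rw [abs_mul, abs_mul, mul_assoc]
    _ ≤ M * R := mul_le_mul hc hxy (by positivity) ((abs_nonneg c).trans hc)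

/-- A forcing `F x` is at most `2 N √E` when `ρ x² ≤ 2E` and `|F| ≤ N √ρ`. [folklore] -/
theorem forcing_le {ρ E N F x : ℝ} (hρ : 0 ≤ ρ) (hN : 0 ≤ N) (hx : ρ * x ^ 2 ≤ 2 * E)
    (hF : |F| ≤ N * Real.sqrt ρ) : F * x ≤ 2 * N * Real.sqrt E := by
  have hE : 0 ≤ E := by nlinarith [mul_nonneg hρ (sq_nonneg x)]
  have h1 : Real.sqrt ρ * |x| ≤ Real.sqrt (2 * E) := by
    rw [← Real.sqrt_sq (abs_nonneg x), sq_abs, ← Real.sqrt_mul hρ]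
    exact Real.sqrt_le_sqrt hx
  have h2 : Real.sqrt (2 * E) ≤ 2 * Real.sqrt E := by
    rw [Real.sqrt_le_left (by positivity), mul_pow, Real.sq_sqrt hE]; linarith
  calc F * x ≤ |F| * |x| := by rw [← abs_mul]; exact le_abs_self _
    _ ≤ N * Real.sqrt ρ * |x| := mul_le_mul_of_nonneg_right hF (abs_nonneg x)
    _ = N * (Real.sqrt ρ * |x|) := mul_assoc _ _ _
    _ ≤ N * (2 * Real.sqrt E) := mul_le_mul_of_nonneg_left (h1.trans h2) hN
    _ = 2 * N * Real.sqrt E := by ring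

/-- From a weighted level-0 amplitude `√X |n| ≤ m` and `1 ≤ κ² ρ X`: `|n| ≤ κ m √ρ`. [folklore] -/
theorem amp_le {X n m κ ρ : ℝ} (h : Real.sqrt X * |n| ≤ m) (hκ : 1 ≤ κ ^ 2 * (ρ * X))
    (hκ0 : 0 ≤ κ) (hρ : 0 ≤ ρ) : |n| ≤ κ * m * Real.sqrt ρ := by
  have h1 := Real.sqrt_le_sqrt hκ
  rw [Real.sqrt_one, Real.sqrt_mul (sq_nonneg _), Real.sqrt_sq hκ0, Real.sqrt_mul hρ] at h1
  calc |n| = |n| * 1 := (mul_one _).symm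
    _ ≤ |n| * (κ * (Real.sqrt ρ * Real.sqrt X)) := mul_le_mul_of_nonneg_left h1 (abs_nonneg n)
    _ = κ * (Real.sqrt X * |n|) * Real.sqrt ρ := by ring
    _ ≤ κ * m * Real.sqrt ρ := by gcongr

/-- Summation of a uniform per-entry bound over the `3 × 3` entries. [folklore] -/
theorem sum9 {ρ M : ℝ} {f : Fin 3 → Fin 3 → ℝ} (h : ∀ l j, ρ * f l j ≤ M) :
    ∑ l, ρ * ∑ j, f l j ≤ 9 * M := by
  simp only [Finset.mul_sum]
  calc ∑ l, ∑ j, ρ * f l j ≤ ∑ _l : Fin 3, ∑ _j : Fin 3, M :=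
        Finset.sum_le_sum fun l _ => Finset.sum_le_sum fun j _ => h l j
    _ = 9 * M := by simp; ring

end Level1U

/-! ### Weights versus reference sizes (registered helper) -/

/-- **The energy weights dominate the reference scales** (helper toward the level-1 group-U
bound, line `log-lipschitz-budget`): in the bootstrap window `ρ ≥ c₁³/2`, `Kc₁²/2 ≤ θ ≤ 3Kc₁²/2`,
`γ = ζ0 + ζ1 ≥ 3/4`, one has `κₐ² ρA ≥ 1`, `κ_b² ρB ≥ 1`, `κ_w² ρ² ≥ 1` for `ρA = θγ`,
`ρB = 3ρ²/(2θ)` and `κₐ = (1 + K⁻¹)/c₁`, `κ_b = (1 + K)/c₁²`, `κ_w = 2/c₁³` (so a level-0 or level-1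
amplitude is controlled by its weighted size times `κ √ρ`, with no `√K`). [folklore] -/
theorem level1_groupU_weights_dominate :
    ∀ (K c₁ ρ θ γ : ℝ), 0 < K → 0 < c₁ → c₁ ^ 3 / 2 ≤ ρ → K * c₁ ^ 2 / 2 ≤ θ →
      θ ≤ 3 / 2 * (K * c₁ ^ 2) → 3 / 4 ≤ γ →
      1 ≤ ((1 + K⁻¹) / c₁) ^ 2 * (θ * γ) ∧ 1 ≤ ((1 + K) / c₁ ^ 2) ^ 2 * (ρ * (3 / 2 * ρ / θ))
        ∧ 1 ≤ (2 / c₁ ^ 3) ^ 2 * (ρ * ρ) := by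
  intro K c₁ ρ θ γ hK hc₁ hρlo hθlo hθhi hγ0
  have hKc : 0 < K * c₁ ^ 2 := by positivity
  have hθ : 0 < θ := by linarith
  have hc3 : 0 < c₁ ^ 3 := by positivity
  have hρ : 0 < ρ := by linarith
  have h5 : c₁ ^ 3 / 2 * (c₁ ^ 3 / 2) ≤ ρ * ρ := mul_le_mul hρlo hρlo (by positivity) hρ.le
  refine ⟨?_, ?_, ?_⟩
  · rw [div_pow, div_mul_eq_mul_div, le_div_iff₀ (by positivity), one_mul]
    have h1 : (1 + K⁻¹) ^ 2 * K = K + 2 + K⁻¹ := by field_simp; ring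
    have h2 : 2 ≤ K + K⁻¹ := by
      have e : K + K⁻¹ - 2 = (K - 1) ^ 2 / K := by field_simp; ring
      have : 0 ≤ (K - 1) ^ 2 / K := by positivity
      linarith
    have h3 : K * c₁ ^ 2 / 2 * (3 / 4) ≤ θ * γ := mul_le_mul hθlo hγ0 (by norm_num) hθ.le
    calc c₁ ^ 2 ≤ 3 / 8 * c₁ ^ 2 * (K + 2 + K⁻¹) := by
          nlinarith [mul_le_mul_of_nonneg_left h2 (sq_nonneg c₁)]
      _ = (1 + K⁻¹) ^ 2 * (K * c₁ ^ 2 / 2 * (3 / 4)) := by rw [← h1]; ring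
      _ ≤ (1 + K⁻¹) ^ 2 * (θ * γ) := by gcongr
  · rw [div_pow, show ρ * (3 / 2 * ρ / θ) = 3 / 2 * ρ ^ 2 / θ by ring, div_mul_div_comm,
      le_div_iff₀ (by positivity), one_mul]
    have h4 : 4 * K ≤ (1 + K) ^ 2 := by nlinarith [sq_nonneg (K - 1)]
    calc (c₁ ^ 2) ^ 2 * θ ≤ (c₁ ^ 2) ^ 2 * (3 / 2 * (K * c₁ ^ 2)) := by gcongr
      _ = 3 / 2 * (4 * K) * (c₁ ^ 3 / 2 * (c₁ ^ 3 / 2)) := by ring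
      _ ≤ 3 / 2 * (1 + K) ^ 2 * (ρ * ρ) := by gcongr
      _ = (1 + K) ^ 2 * (3 / 2 * ρ ^ 2) := by ring
  · rw [div_pow, div_mul_eq_mul_div, le_div_iff₀ (by positivity), one_mul]
    calc (c₁ ^ 3) ^ 2 = 2 ^ 2 * (c₁ ^ 3 / 2 * (c₁ ^ 3 / 2)) := by ring
      _ ≤ 2 ^ 2 * (ρ * ρ) := by gcongr

namespace Level1U

/-! ### The envelope -/

/-- The envelope scale `V = (1 + c₁ + c₁⁻¹)³ (1 + K + K⁻¹)` dominates every reference size used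
below, and `V⁴ ≤ (1 + c₁ + c₁⁻¹)¹² (1 + K + K⁻¹)¹²`. [folklore] -/
theorem env_facts {K c₁ : ℝ} (hK : 0 < K) (hc₁ : 0 < c₁) :
    let P := 1 + c₁ + c₁⁻¹
    let Q := 1 + K + K⁻¹
    let V := P ^ 3 * Q
    1 ≤ V ∧ K ≤ V ∧ c₁ ≤ V ∧ c₁ ^ 3 ≤ V ∧ c₁⁻¹ ≤ V ∧ (1 + K⁻¹) / c₁ ≤ V ∧ (1 + K) / c₁ ^ 2 ≤ V
      ∧ V ^ 4 ≤ P ^ 12 * Q ^ 12 := by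
  intro P Q V
  have hci : 0 < c₁⁻¹ := inv_pos.2 hc₁
  have hKi : 0 < K⁻¹ := inv_pos.2 hK
  have hP1 : 1 ≤ P := by show 1 ≤ 1 + c₁ + c₁⁻¹; linarith [hci.le, hc₁.le]
  have hQ1 : 1 ≤ Q := by show 1 ≤ 1 + K + K⁻¹; linarith [hKi.le, hK.le]
  have hcP : c₁ ≤ P := by show c₁ ≤ 1 + c₁ + c₁⁻¹; linarith [hci.le]
  have hiP : c₁⁻¹ ≤ P := by show c₁⁻¹ ≤ 1 + c₁ + c₁⁻¹; linarith [hc₁.le]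
  have hKQ : K ≤ Q := by show K ≤ 1 + K + K⁻¹; linarith [hKi.le]
  have hK1Q : 1 + K ≤ Q := by show _ ≤ 1 + K + K⁻¹; linarith [hKi.le]
  have hKiQ : 1 + K⁻¹ ≤ Q := by show _ ≤ 1 + K + K⁻¹; linarith [hK.le]
  have hQ0 : 0 ≤ Q := zero_le_one.trans hQ1
  have hP3 : 1 ≤ P ^ 3 := one_le_pow₀ hP1
  have hPP3 : P ≤ P ^ 3 := le_self_pow₀ hP1 three_ne_zero
  have hP23 : P ^ 2 ≤ P ^ 3 := pow_le_pow_right₀ hP1 (by norm_num)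
  have hV : P ^ 3 ≤ V := le_mul_of_one_le_right (by positivity) hQ1
  have hQV : Q ≤ V := le_mul_of_one_le_left hQ0 hP3
  refine ⟨hP3.trans hV, hKQ.trans hQV, hcP.trans (hPP3.trans hV),
    (pow_le_pow_left₀ hc₁.le hcP 3).trans hV, hiP.trans (hPP3.trans hV), ?_, ?_, ?_⟩
  · rw [div_eq_mul_inv]
    calc (1 + K⁻¹) * c₁⁻¹ ≤ Q * P := mul_le_mul hKiQ hiP hci.le hQ0
      _ ≤ Q * P ^ 3 := mul_le_mul_of_nonneg_left hPP3 hQ0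
      _ = V := mul_comm _ _
  · rw [div_eq_mul_inv, ← inv_pow]
    calc (1 + K) * c₁⁻¹ ^ 2 ≤ Q * P ^ 2 :=
          mul_le_mul hK1Q (pow_le_pow_left₀ hci.le hiP 2) (by positivity) hQ0
      _ ≤ Q * P ^ 3 := mul_le_mul_of_nonneg_left hP23 hQ0
      _ = V := mul_comm _ _
  · show (P ^ 3 * Q) ^ 4 ≤ P ^ 12 * Q ^ 12
    rw [mul_pow, ← pow_mul]
    exact mul_le_mul_of_nonneg_left (pow_le_pow_right₀ hQ1 (by norm_num)) (by positivity)

/-- Final bookkeeping of the forcing constants against the envelope. [folklore] -/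
theorem env_final {C L Rv cZ s3 m₀ V W ε : ℝ} (hL : 0 ≤ L) (hRv : 0 ≤ Rv)
    (hcZ : 0 ≤ cZ) (hs3 : 0 ≤ s3) (hm₀ : 0 ≤ m₀) (hε : ε = C * L)
    (hVW : V ^ 4 ≤ W) (hW : 1 ≤ W) :
    18 * Rv * m₀ + 2 * ((ε ^ 2 * (342 * cZ * s3 + 87 / 2 * m₀)
        + Rv * (18 * cZ * s3 + 9 / 4 * m₀)) * V ^ 4)
      ≤ 2 * (C ^ 2 + 1) * (342 * cZ + 44) * (1 + L) ^ 2 * (1 + Rv) * W * (m₀ + s3) := by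
  subst hε
  set N := (C * L) ^ 2 * (342 * cZ * s3 + 87 / 2 * m₀) + Rv * (18 * cZ * s3 + 9 / 4 * m₀) with hN
  have hN0 : 0 ≤ N := by positivity
  have h1 : 18 * Rv * m₀ + 2 * (N * V ^ 4) ≤ (18 * Rv * m₀ + 2 * N) * W := by
    have e1 := mul_le_mul_of_nonneg_left hW (by positivity : (0 : ℝ) ≤ 18 * Rv * m₀)
    have e2 := mul_le_mul_of_nonneg_left hVW (by positivity : (0 : ℝ) ≤ 2 * N)
    linarith
  have h2 : 18 * Rv * m₀ + 2 * N ≤ 2 * (C ^ 2 + 1) * (342 * cZ + 44) * (1 + L) ^ 2 * (1 + Rv)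
      * (m₀ + s3) := by
    rw [hN, ← sub_nonneg]; ring_nf; positivity
  calc 18 * Rv * m₀ + 2 * (N * V ^ 4) ≤ (18 * Rv * m₀ + 2 * N) * W := h1
    _ ≤ 2 * (C ^ 2 + 1) * (342 * cZ + 44) * (1 + L) ^ 2 * (1 + Rv) * (m₀ + s3) * W :=
        mul_le_mul_of_nonneg_right h2 (zero_le_one.trans hW)
    _ = _ := by ring

end Level1U

end Summit.AtomisticToContinuum.HydrodynamicLimit.Theorems
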